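import Literature.Computability.AlgebraicComplexity.MS21ANFOrbitsDistinctDepthProofs
import HarnessLib

/-!
# Medini–Shpilka 2021, §5: the derivative structure of the canonical ROANF `ANF_Δ`
# (Obs 5.8, Cor 5.10; multilinearity, Obs 5.2 / Obs 5.7)

Theorem-only companion of `MS21DenseOrbitsHittingSets.lean` (cell `val-lit`, seat x5 g3; registry
claim `MS2021_thm_35`, partial by design — third file: the structural lemmas about `ANF_Δ` on
which the equal-depth case of Thm 35 (§5.2: Lemmas 5.12–5.15, Lemma `pitRoanfSame`) runs).
Source: D. Medini, A. Shpilka, CCC 2021 (LIPIcs 200:19) = arXiv:2102.05632, §5 (arXiv p0025).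

* **Obs 5.8 (`derivCroanf`), one level of the recursion** (`pderiv_anf_succ`): for a variable
  `x^{(b)}_j` of block `b`, `∂ ANF_{Δ+1} / ∂ x^{(b)}_j = ANF_Δ(x^{(sib b)}) · (∂ ANF_Δ/∂ x_j)(x^{(b)})`
  where `sib b` is the sibling block under the common product gate (`0 ↔ 1`, `2 ↔ 3`, which is
  `1 - b` in `Fin 4`): the printed "`∂ ANF_Δ/∂ x_i = ∏_k sib(v_k)`" (arXiv p0025:L57–L60) is this
  identity iterated down the tree. Tools: derivatives commute with injective renamings (Mathlib
  `pderiv_rename`) and vanish along absent variables.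
* **Obs 5.2 / Obs 5.7, multilinearity** (`degreeOf_anf_le_one`): every variable has individual
  degree `≤ 1` in `ANF_Δ` ("read-once polynomials are always multilinear", p0025:L15).
* Every variable occurs: `pderiv_anf_ne_zero`; derivatives of homogeneous polynomials are
  homogeneous of one degree less (private `isHomogeneous_pderiv_of_isHomogeneous`, folklore), so
  `∂ANF_Δ/∂x_i` is homogeneous of degree `2^Δ - 1` (`isHomogeneous_pderiv_anf`).
* **Cor 5.10 (`derivCroanfNonZero`)** (`sum_C_mul_pderiv_anf_ne_zero`): "For any `0 ≠ u ∈ F^{4^Δ}`,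
  `∂ ANF_Δ/∂ u` is non-zero", i.e. `Σ_i u_i ∂ANF_Δ/∂x_i ≠ 0`, by the printed argument (p0025:L67–
  L70: no cancellation between the `∂/∂x_i`) organised along the recursion: the four block terms
  `ANF_Δ(x^{(sib b)}) · (∂_{u_b} ANF_Δ)(x^{(b)})` of `∂_u ANF_{Δ+1}` have pairwise different
  block-degree profiles (degree `2^Δ` in block `sib b`, `2^Δ - 1` in block `b`, `0` elsewhere), so a
  monomial of a nonzero block term is a monomial of the sum.

No definitions, no new named facts (D-0026). HONEST FRAMING: infrastructure toward the typed
literature statement `MS2021_thm_35` (equal-depth case); `VP ≠ VNP` is NOT proved and nothing here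
bears on it.

## References
* [MediniShpilka2021] D. Medini, A. Shpilka, CCC 2021, LIPIcs 200:19 = arXiv:2102.05632: Def 8 /
  Def 5.4 (CCC p.19:7; arXiv p0025:L28–L39), Obs 5.2 (p0025:L15), Obs 5.7 (p0025:L54), Obs 5.8
  (p0025:L57–L60), Cor 5.9 (p0025:L62), Cor 5.10 (p0025:L65–L70).
-/

noncomputable section

open MvPolynomial

namespace Literature.Computability.AlgebraicComplexity

namespace MS2021

/-! ### Derivatives, individual degrees and renamings -/

section PDerivRename

variable {R : Type*} [CommSemiring R] {σ τ : Type*}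

/-- A partial derivative along a variable outside the range of a renaming kills the renamed
polynomial. [folklore] -/
private theorem pderiv_rename_eq_zero_of_forall_ne (e : σ → τ) (x : τ)
    (hx : ∀ j, e j ≠ x) (p : MvPolynomial σ R) : pderiv x (rename e p) = 0 := by
  classical
  apply pderiv_eq_zero_of_notMem_vars
  intro h
  obtain ⟨j, -, hj⟩ := Finset.mem_image.1 (vars_rename e p h)
  exact hx j hj

/-- The individual degree of a variable outside the range of a renaming is `0`. [folklore] -/
private theorem degreeOf_rename_eq_zero_of_forall_ne (e : σ → τ) (x : τ)
    (hx : ∀ j, e j ≠ x) (p : MvPolynomial σ R) : degreeOf x (rename e p) = 0 := by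
  classical
  by_contra h
  obtain ⟨j, -, hj⟩ := Finset.mem_image.1 (vars_rename e p (mem_vars_iff_degreeOf_ne_zero.2 h))
  exact hx j hj

/-- **Derivatives of homogeneous polynomials are homogeneous of one degree less.** [folklore] -/
private theorem isHomogeneous_pderiv_of_isHomogeneous {p : MvPolynomial σ R} {d : ℕ}
    (hp : p.IsHomogeneous d) (x : σ) : (pderiv x p).IsHomogeneous (d - 1) := by
  classical
  intro m hm
  rw [coeff_pderiv] at hm
  have hc : coeff (m + Finsupp.single x 1) p ≠ 0 := fun h => hm (by rw [h, zero_mul])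
  have hdeg := hp hc
  rw [Finsupp.weight_apply] at hdeg ⊢
  simp only [Pi.one_apply, smul_eq_mul, mul_one] at hdeg ⊢
  rw [Finsupp.sum_add_index' (fun _ => rfl) (fun _ _ _ => rfl), Finsupp.sum_single_index rfl] at hdeg
  omega

end PDerivRename

/-! ### Obs 5.8: one level of the derivative recursion -/

section DerivCroanf

variable (K : Type*) [Field K]

/-- `ANF_{Δ+1}` unfolded along Def 8. [cite: MediniShpilka2021, Def 8 / Def 5.4 (CCC p.19:7; arXiv p0025:L31-L37)] -/
theorem anf_succ (Δ : ℕ) : anf K (Δ + 1) =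
    rename (anfBlock Δ 0) (anf K Δ) * rename (anfBlock Δ 1) (anf K Δ) +
      rename (anfBlock Δ 2) (anf K Δ) * rename (anfBlock Δ 3) (anf K Δ) := rfl

/-- Derivative of a renamed block along a variable of ANOTHER block vanishes.
[cite: MediniShpilka2021, Obs 5.8 (arXiv p0025:L57-L60)] -/
theorem pderiv_anfBlock_rename_of_ne {Δ : ℕ} {b b' : Fin 4} (hb : b' ≠ b) (j : Fin (4 ^ Δ))
    (p : MvPolynomial (Fin (4 ^ Δ)) K) :
    pderiv (anfBlock Δ b j) (rename (anfBlock Δ b') p) = 0 :=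
  pderiv_rename_eq_zero_of_forall_ne _ _ (fun _ h => hb (anfBlock_inj h).1) p

/-- Derivative of a renamed block along one of ITS variables is the renamed derivative.
[cite: MediniShpilka2021, Obs 5.8 (arXiv p0025:L57-L60)] -/
theorem pderiv_anfBlock_rename_self {Δ : ℕ} (b : Fin 4) (j : Fin (4 ^ Δ))
    (p : MvPolynomial (Fin (4 ^ Δ)) K) :
    pderiv (anfBlock Δ b j) (rename (anfBlock Δ b) p) = rename (anfBlock Δ b) (pderiv j p) :=
  pderiv_rename (anfBlock_injective Δ b) j p

/-- **Obs 5.8 (`derivCroanf`), one level.** For a variable `x^{(b)}_j` of block `b`,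
`∂ ANF_{Δ+1}/∂ x^{(b)}_j = ANF_Δ(x^{(sib b)}) · (∂ANF_Δ/∂x_j)(x^{(b)})`, where the sibling block under
the common product gate is `sib b = 1 - b` in `Fin 4` (`0 ↔ 1`, `2 ↔ 3`); iterating down the tree
gives the printed `∂ANF_Δ/∂x_i = ∏_{k<Δ} sib(v_k)`.
[cite: MediniShpilka2021, Obs 5.8 (arXiv p0025:L57-L60)] -/
theorem pderiv_anf_succ (Δ : ℕ) (b : Fin 4) (j : Fin (4 ^ Δ)) :
    pderiv (anfBlock Δ b j) (anf K (Δ + 1)) =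
      rename (anfBlock Δ (1 - b)) (anf K Δ) * rename (anfBlock Δ b) (pderiv j (anf K Δ)) := by
  rw [anf_succ, map_add, Derivation.leibniz, Derivation.leibniz]
  simp only [smul_eq_mul]
  have h2 : (1 : Fin 4) - 2 = 3 := by decide
  have h3 : (1 : Fin 4) - 3 = 2 := by decide
  fin_cases b
  · simp only [Fin.zero_eta, Fin.isValue, sub_zero]
    rw [pderiv_anfBlock_rename_self, pderiv_anfBlock_rename_of_ne K (by decide),
      pderiv_anfBlock_rename_of_ne K (by decide), pderiv_anfBlock_rename_of_ne K (by decide)]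
    ring
  · simp only [Fin.mk_one, Fin.isValue, sub_self]
    rw [pderiv_anfBlock_rename_self, pderiv_anfBlock_rename_of_ne K (by decide),
      pderiv_anfBlock_rename_of_ne K (by decide), pderiv_anfBlock_rename_of_ne K (by decide)]
    ring
  · simp only [Fin.reduceFinMk, Fin.isValue, h2]
    rw [pderiv_anfBlock_rename_self, pderiv_anfBlock_rename_of_ne K (by decide),
      pderiv_anfBlock_rename_of_ne K (by decide), pderiv_anfBlock_rename_of_ne K (by decide)]
    ring
  · simp only [Fin.reduceFinMk, Fin.isValue, h3]
    rw [pderiv_anfBlock_rename_self, pderiv_anfBlock_rename_of_ne K (by decide),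
      pderiv_anfBlock_rename_of_ne K (by decide), pderiv_anfBlock_rename_of_ne K (by decide)]
    ring

end DerivCroanf

/-! ### Multilinearity (Obs 5.2 / Obs 5.7), occurrence of every variable, degrees of derivatives -/

section Multilinear

variable (K : Type*) [Field K]

/-- Individual degree of a renamed block: along a variable of another block it is `0`.
[cite: MediniShpilka2021, Def 8 / Def 5.4 (CCC p.19:7; arXiv p0025:L31-L37)] -/
theorem degreeOf_anfBlock_rename_of_ne {Δ : ℕ} {b b' : Fin 4} (hb : b' ≠ b) (j : Fin (4 ^ Δ))
    (p : MvPolynomial (Fin (4 ^ Δ)) K) :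
    degreeOf (anfBlock Δ b j) (rename (anfBlock Δ b') p) = 0 :=
  degreeOf_rename_eq_zero_of_forall_ne _ _ (fun _ h => hb (anfBlock_inj h).1) p

/-- Individual degree of a renamed block along one of its variables.
[cite: MediniShpilka2021, Def 8 / Def 5.4 (CCC p.19:7; arXiv p0025:L31-L37)] -/
theorem degreeOf_anfBlock_rename_self {Δ : ℕ} (b : Fin 4) (j : Fin (4 ^ Δ))
    (p : MvPolynomial (Fin (4 ^ Δ)) K) :
    degreeOf (anfBlock Δ b j) (rename (anfBlock Δ b) p) = degreeOf j p :=
  degreeOf_rename_of_injective (anfBlock_injective Δ b) j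

/-- **Obs 5.2: "Read-once polynomials are always multilinear polynomials"** — every variable has
individual degree `≤ 1` in a read-once polynomial (leaf sets of the two children are disjoint, and a
read-once polynomial only involves the variables of its leaf set).
[cite: MediniShpilka2021, Obs 5.2 (arXiv p0025:L15)] -/
theorem IsROP.degreeOf_le_one {σ : Type*} [DecidableEq σ] {S : Finset σ} {f : MvPolynomial σ K}
    (h : IsROP S f) (x : σ) : degreeOf x f ≤ 1 := by
  classical
  -- a variable outside the leaf set has individual degree `0`
  have hout : ∀ {S' : Finset σ} {g : MvPolynomial σ K}, IsROP S' g → x ∉ S' → degreeOf x g = 0 := by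
    intro S' g hg hx
    by_contra hne
    exact hx (hg.vars_subset (mem_vars_iff_degreeOf_ne_zero.2 hne))
  induction h with
  | leaf i α β =>
    refine (degreeOf_add_le _ _ _).trans (max_le ?_ ?_)
    · refine (degreeOf_mul_le _ _ _).trans ?_
      rw [degreeOf_C, zero_add, degreeOf_X]
      split_ifs <;> omega
    · rw [degreeOf_C]; exact zero_le_one
  | add α h₁ h₂ hd ih₁ ih₂ =>
    refine (degreeOf_add_le _ _ _).trans (max_le ((degreeOf_add_le _ _ _).trans (max_le ih₁ ih₂)) ?_)
    rw [degreeOf_C]; exact zero_le_one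
  | @mul S₁ S₂ f g α h₁ h₂ hd ih₁ ih₂ =>
    refine (degreeOf_add_le _ _ _).trans (max_le ((degreeOf_mul_le _ _ _).trans ?_) ?_)
    · by_cases hx : x ∈ S₁
      · rw [hout h₂ (Finset.disjoint_left.1 hd hx), add_zero]; exact ih₁
      · rw [hout h₁ hx, zero_add]; exact ih₂
    · rw [degreeOf_C]; exact zero_le_one

/-- **`ANF_Δ` is multilinear** (Obs 5.2 / Obs 5.7): every variable has individual degree `≤ 1`.
[cite: MediniShpilka2021, Obs 5.2 and Obs 5.7 (arXiv p0025:L15, L54)] -/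
theorem degreeOf_anf_le_one (Δ : ℕ) (x : Fin (4 ^ Δ)) : degreeOf x (anf K Δ) ≤ 1 :=
  (isROP_anf K Δ).degreeOf_le_one K x

/-- **Every variable occurs in `ANF_Δ`**: `∂ANF_Δ/∂x_i ≠ 0` (Obs 5.8: the derivative is a product of
sibling ROANFs, hence nonzero). [cite: MediniShpilka2021, Obs 5.8 and Cor 5.10 (arXiv p0025:L57-L70)] -/
theorem pderiv_anf_ne_zero : ∀ (Δ : ℕ) (x : Fin (4 ^ Δ)), pderiv x (anf K Δ) ≠ 0
  | 0, x => by
    classical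
    simp only [anf]
    obtain rfl : x = ⟨0, by norm_num⟩ := by
      ext; have := x.2; simp only [pow_zero] at this; simp only; omega
    rw [pderiv_X_self]
    exact one_ne_zero
  | Δ + 1, x => by
    obtain ⟨i, j, rfl⟩ := exists_eq_anfBlock Δ x
    rw [pderiv_anf_succ]
    refine mul_ne_zero ?_ ?_
    · exact fun h => anf_ne_zero K Δ
        ((rename_injective _ (anfBlock_injective Δ _)).eq_iff' (map_zero _) |>.1 h)
    · exact fun h => pderiv_anf_ne_zero Δ j
        ((rename_injective _ (anfBlock_injective Δ _)).eq_iff' (map_zero _) |>.1 h)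

/-- `∂ANF_Δ/∂x_i` is homogeneous of degree `2^Δ - 1`. [cite: MediniShpilka2021, Obs 5.8 (arXiv p0025:L57-L60)] -/
theorem isHomogeneous_pderiv_anf (Δ : ℕ) (x : Fin (4 ^ Δ)) :
    (pderiv x (anf K Δ)).IsHomogeneous (2 ^ Δ - 1) :=
  isHomogeneous_pderiv_of_isHomogeneous (isHomogeneous_anf K Δ) x

/-- A directional derivative `Σ_i u_i ∂ANF_Δ/∂x_i` is homogeneous of degree `2^Δ - 1`.
[cite: MediniShpilka2021, Cor 5.10 (arXiv p0025:L65-L70); Def 3.6] -/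
theorem isHomogeneous_sum_C_mul_pderiv_anf (Δ : ℕ) (u : Fin (4 ^ Δ) → K) :
    (∑ i, C (u i) * pderiv i (anf K Δ)).IsHomogeneous (2 ^ Δ - 1) :=
  IsHomogeneous.sum _ _ _ fun i _ => (isHomogeneous_pderiv_anf K Δ i).C_mul (u i)

end Multilinear

/-! ### Cor 5.10: `∂ANF_Δ/∂u ≠ 0` for `u ≠ 0` -/

section DerivNonZero

variable (K : Type*) [Field K]

/-- Block degree of a monomial supported in one renamed block. [folklore] -/
private theorem blockSum_of_mem_support_rename {Δ : ℕ} (b b' : Fin 4)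
    {p : MvPolynomial (Fin (4 ^ Δ)) K} {ν : Fin (4 ^ (Δ + 1)) →₀ ℕ}
    (hν : ν ∈ (rename (anfBlock Δ b) p).support) :
    ∃ ν' ∈ p.support, (∑ j, ν (anfBlock Δ b' j)) = if b' = b then ν'.degree else 0 := by
  classical
  rw [support_rename_of_injective (anfBlock_injective Δ b)] at hν
  obtain ⟨ν', hν', rfl⟩ := Finset.mem_image.1 hν
  refine ⟨ν', hν', ?_⟩
  by_cases hb : b' = b
  · subst hb
    rw [if_pos rfl]
    simp_rw [Finsupp.mapDomain_apply (anfBlock_injective Δ b')]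
    rw [Finsupp.degree_eq_sum]
  · rw [if_neg hb]
    refine Finset.sum_eq_zero fun j _ => ?_
    rw [Finsupp.mapDomain_notin_range]
    rintro ⟨j', h⟩
    exact hb (anfBlock_inj h).1.symm

/-- Block degrees of the monomials of a block term `ANF_Δ(x^{(a)}) · D(x^{(b)})`, `D` homogeneous of
degree `d`: `2^Δ` in block `a`, `d` in block `b`, `0` elsewhere. [folklore] -/
private theorem blockSum_of_mem_support_term {Δ d : ℕ} {a b : Fin 4}
    {D : MvPolynomial (Fin (4 ^ Δ)) K} (hD : D.IsHomogeneous d) (b' : Fin 4)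
    {ν : Fin (4 ^ (Δ + 1)) →₀ ℕ}
    (hν : ν ∈ (rename (anfBlock Δ a) (anf K Δ) * rename (anfBlock Δ b) D).support) :
    (∑ j, ν (anfBlock Δ b' j)) = (if b' = a then 2 ^ Δ else 0) + (if b' = b then d else 0) := by
  classical
  obtain ⟨α, hα, β, hβ, rfl⟩ := Finset.mem_add.1 (support_mul _ _ hν)
  obtain ⟨α', hα', hαsum⟩ := blockSum_of_mem_support_rename K a b' hα
  obtain ⟨β', hβ', hβsum⟩ := blockSum_of_mem_support_rename K b b' hβ
  have hαdeg : α'.degree = 2 ^ Δ :=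
    ((isHomogeneous_anf K Δ).degree_eq_sum_deg_support hα').symm
  have hβdeg : β'.degree = d := (hD.degree_eq_sum_deg_support hβ').symm
  simp only [Finsupp.coe_add, Pi.add_apply, Finset.sum_add_distrib, hαsum, hβsum, hαdeg, hβdeg]

/-- **Cor 5.10 (`derivCroanfNonZero`).** "For any `0 ≠ u ∈ F^{4^Δ}`, `∂ANF_Δ/∂u` is non-zero":
`Σ_i u_i ∂ANF_Δ/∂x_i ≠ 0` ("no cancellations can occur as the monomial sets in the summed
polynomials are disjoint", p0025:L70). [cite: MediniShpilka2021, Cor 5.10 (arXiv p0025:L65-L70)] -/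
theorem sum_C_mul_pderiv_anf_ne_zero : ∀ (Δ : ℕ) (u : Fin (4 ^ Δ) → K), u ≠ 0 →
    ∑ i, C (u i) * pderiv i (anf K Δ) ≠ 0
  | 0, u, hu => by
    classical
    have h0 : u ⟨0, by norm_num⟩ ≠ 0 := by
      intro h
      apply hu
      funext x
      obtain rfl : x = ⟨0, by norm_num⟩ := by
        ext; have := x.2; simp only [pow_zero] at this; simp only; omega
      exact h
    have huniv : (Finset.univ : Finset (Fin (4 ^ 0))) = {⟨0, by norm_num⟩} := by
      ext x
      simp only [Finset.mem_univ, Finset.mem_singleton, true_iff]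
      ext; have := x.2; simp only [pow_zero] at this; simp only; omega
    rw [huniv, Finset.sum_singleton]
    simp only [anf, pderiv_X_self, mul_one, Ne, C_eq_zero]
    exact h0
  | Δ + 1, u, hu => by
    classical
    -- regroup the sum by blocks
    set D : Fin 4 → MvPolynomial (Fin (4 ^ Δ)) K := fun b =>
      ∑ j, C (u (anfBlock Δ b j)) * pderiv j (anf K Δ) with hD
    set T : Fin 4 → MvPolynomial (Fin (4 ^ (Δ + 1))) K := fun b =>
      rename (anfBlock Δ (1 - b)) (anf K Δ) * rename (anfBlock Δ b) (D b) with hT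
    have hsum : ∑ i, C (u i) * pderiv i (anf K (Δ + 1)) = ∑ b, T b := by
      -- reindex along `(b, j) ↦ x^{(b)}_j`
      let e : Fin 4 × Fin (4 ^ Δ) ≃ Fin (4 ^ (Δ + 1)) :=
        finProdFinEquiv.trans (finCongr (pow_succ' 4 Δ).symm)
      have he : ∀ p : Fin 4 × Fin (4 ^ Δ), e p = anfBlock Δ p.1 p.2 := fun p => rfl
      rw [← e.sum_comp, Fintype.sum_prod_type]
      refine Finset.sum_congr rfl fun b _ => ?_
      simp only [he, pderiv_anf_succ, hT, hD, map_sum, map_mul, rename_C, Finset.mul_sum]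
      refine Finset.sum_congr rfl fun j _ => ?_
      ring
    rw [hsum]
    -- a block `b₀` where `u` is nonzero
    obtain ⟨x, hx⟩ : ∃ x, u x ≠ 0 := by
      by_contra h
      push Not at h
      exact hu (funext h)
    obtain ⟨b₀, j₀, rfl⟩ := exists_eq_anfBlock Δ x
    have hDb₀ : D b₀ ≠ 0 := by
      refine sum_C_mul_pderiv_anf_ne_zero Δ (fun j => u (anfBlock Δ b₀ j)) ?_
      intro h
      exact hx (congrFun h j₀)
    have hT₀ : T b₀ ≠ 0 := by
      refine mul_ne_zero ?_ ?_
      · exact fun h => anf_ne_zero K Δ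
          ((rename_injective _ (anfBlock_injective Δ _)).eq_iff' (map_zero _) |>.1 h)
      · exact fun h => hDb₀
          ((rename_injective _ (anfBlock_injective Δ _)).eq_iff' (map_zero _) |>.1 h)
    -- a monomial of `T b₀` is a monomial of the sum: block-degree profiles differ
    obtain ⟨μ, hμ⟩ := Finset.nonempty_iff_ne_empty.2 (support_eq_empty.not.2 hT₀)
    have hDhom : ∀ b, (D b).IsHomogeneous (2 ^ Δ - 1) := fun b =>
      isHomogeneous_sum_C_mul_pderiv_anf K Δ _
    have hsib : ∀ b : Fin 4, 1 - b ≠ b := by decide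
    have hprof := fun (b b' : Fin 4) {ν} (hν : ν ∈ (T b).support) =>
      blockSum_of_mem_support_term K (a := 1 - b) (hDhom b) b' hν
    have hpow : 1 ≤ 2 ^ Δ := Nat.one_le_two_pow
    have hcoeff : ∀ b, b ≠ b₀ → coeff μ (T b) = 0 := by
      intro b hb
      by_contra hne
      have hμb : μ ∈ (T b).support := mem_support_iff.2 hne
      by_cases hs : b = 1 - b₀
      · -- the sibling term: compare block `b₀`
        have e1 := hprof b₀ b₀ hμ
        have e2 := hprof b b₀ hμb
        subst hs
        rw [if_neg (hsib b₀).symm, if_pos rfl] at e1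
        rw [if_pos (sub_sub_cancel 1 b₀).symm, if_neg (hsib b₀).symm] at e2
        omega
      · -- an unrelated term: compare block `1 - b₀`
        have e1 := hprof b₀ (1 - b₀) hμ
        have e2 := hprof b (1 - b₀) hμb
        rw [if_pos rfl, if_neg (hsib b₀)] at e1
        have hne1 : 1 - b₀ ≠ 1 - b := fun h => hb (sub_right_injective h).symm
        have hne2 : 1 - b₀ ≠ b := fun h => hs h.symm
        rw [if_neg hne1, if_neg hne2] at e2
        omega
    intro h0
    have := congrArg (coeff μ) h0
    rw [coeff_sum, coeff_zero, Finset.sum_eq_single b₀ (fun b _ hb => hcoeff b hb)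
      (fun h => absurd (Finset.mem_univ _) h)] at this
    exact (mem_support_iff.1 hμ) this

end DerivNonZero

end MS2021

end Literature.Computability.AlgebraicComplexity

end
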